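import Literature.NumberTheory.GaloisRepresentations.IdeleExtensionLocalGlobal
import Literature.NumberTheory.GaloisRepresentations.HomDualReadoutNaturality
import Literature.Algebra.Homology.ExtPresentationBoundary
import HarnessLib

/-!
# The idèle-torus Hasse principle for lattices: a class of `Ext¹_{C_Γ}(X, F̄ˣ)` whose native avatar
# `δ₀ u₀ ∈ H¹(K, Hom_ℤ(X, K̄ˣ))` is LOCALLY TRIVIAL at every place dies in `Ext¹_{C_Γ}(X, J̄)`
# (input (B) of property (e) `Ш²(K, M^D) ⊆ Im Ψ` of the `Ш²`-readout road to Milne *ADT* I Thm. 4.10 (a))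

Topic `NumberTheory/GaloisRepresentations`; namespace `Literature.NumberTheory.GaloisRepresentations.IdeleReadout`.
Theorems only (no definition, no named fact, no instance, no notation, no `sorry`); number fields in `Type`.
The `Ext`/native wrappers of this seat's Hom-level local-to-global extension principle
`exists_comp_eq_unitsToIdele_of_localExtensions` (`IdeleExtensionLocalGlobal`), through door-c6 g16's `boundary`
(`ExtPresentationBoundary`: `Ext¹(X, A) ∋ ∂ u₀ = [S] ∘ u₀`) and `dualδ₀` (`HomDualPresentation`: the native connecting map
`Hom_Γ(X₁, A) → H¹(K, Hom_ℤ(X, A))`, `dualδ₀_eq_zero_iff`, and its compatibility with restriction of the field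
`map_res_dualδ₀_eq` of `HomDualReadoutNaturality`).

THE MATHEMATICS.  `K` a number field, `S : 0 → X₁ —ι→ X₂ —π→ X → 0` a short exact sequence in door-c4's
`C_Γ = DiscreteRepCat ℤ Γ_K` of finite-type objects trivialised by a layer `E` (intended: a cover of a LATTICE `X` by a
permutation lattice `X₂`, e.g. of the relation module `N₁` of the presentation of a finite Galois module), and
`u₀ : X₁ ⟶ F̄ˣ = lim→ Eˣ` (door-c5 g16 `unitsBarD K`) with class `y = ∂ u₀ ∈ Ext¹_{C_Γ}(X, F̄ˣ)` — every class is of this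
form when `Ext¹(X₂, F̄ˣ) = 0` (`boundary_surjective`; Hilbert 90 for a permutation lattice,
`FreePresentation.ext_presLattice_unitsBarD_eq_zero`).  The native avatar of `y` is
`δ₀(ι ∘ u₀) ∈ H¹(K, Hom_ℤ(X, K̄ˣ)) = H¹(K, T(K̄))`, `T` the torus with character lattice `X` (Milne I 0.8).
**If at every place `v` the local class `δ₀^{K_v}(ι_v ∘ u₀) ∈ H¹(K_v, Hom_ℤ(X, K̄_vˣ))` vanishes** — equivalently
(`map_res_dualδ₀_eq`) the restriction `res_v δ₀(ι ∘ u₀)` pushed along `K̄ˣ → K̄_vˣ` vanishes, i.e. `y ∈ Ш¹(K, T)` —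
**then `y ∘ [F̄ˣ → J̄] = 0` in `Ext¹_{C_Γ}(X, J̄)`** (`boundary_comp_unitsToIdele_eq_zero_of_forall_dualδ₀_eq_zero`,
`…_of_forall_map_res_dualδ₀_eq_zero`): local vanishing means that `ι_v ∘ u₀` extends `Γ_{K_v}`-equivariantly to `X₂`
(`dualδ₀_eq_zero_iff`), so `u₀ ≫ (F̄ˣ → J̄)` extends to `X₂ ⟶ J̄` (`exists_comp_eq_unitsToIdele_of_localExtensions`:
unit correction at the unramified places + door-c5 g17's idèle assembly + uniqueness), i.e. `∂(u₀ ≫ (F̄ˣ → J̄)) = 0`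
(`boundary_eq_zero_iff`), and `∂(u₀ ≫ f) = (∂ u₀) ∘ f` (`boundary_comp`).  In classical terms:
`H¹(K, T(𝔸_K̄)) ↪ ∏_v H¹(K_v, T)` (Milne I Lemma 4.13 in degree one for a torus), applied to the image of `Ш¹(K, T)`.

USE.  Property (e) of the `Ш²`-readout road (`PoitouTateShaTwoReadout.poitouTate_sha_tateDual_of_shaTwoObstruction`,
hypothesis `hΨsurj`) is `ExtPresentation.exists_obstruction_eq_of_forall_shift hS hT x hA hB`
(`ExtPresentationObstructionImage`) with `hA` = "`x` dies on the permutation lattice `P`" (Brauer–Hasse–Noether) and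
`hB y _ := boundary_comp_unitsToIdele_eq_zero_of_forall_map_res_dualδ₀_eq_zero …` once the degree-two localisation
bridge identifies "`extTwoToTateDual ([S] ∘ ∂ u₀) ∈ Ш²(K, M^D)`" with the local vanishing of `res_v δ₀(ι ∘ u₀)`.
HONEST FRAMING: no case of Poitou–Tate or BSD is proved here.

## References
* J. S. Milne, *Arithmetic Duality Theorems* (2nd ed. 2006), I §0 (0.8), I Lemma 4.13, proof of Thm. 4.10 (p. 58).
  [MilneADT2006]
* J. W. S. Cassels, A. Fröhlich (eds.), *Algebraic Number Theory* (1967), Ch. VII (Tate) §8 Prop. 8.1, §9.7.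
  [CasselsFrohlichANT1967]
* C. A. Weibel, *An introduction to homological algebra* (1994), §2.7, Thm. 2.7.6. [Weibel1994]
-/

noncomputable section

open NumberField NumberField.InfinitePlace IsDedekindDomain Field CategoryTheory CategoryTheory.Abelian
open Literature.NumberTheory.Automorphic

namespace Literature.NumberTheory.GaloisRepresentations

namespace IdeleReadout

open SemiLocal ArchHerbrand DiscreteGaloisModule IdeleCohomology IdeleClassBar HomDual DGMBridge
  Literature.Algebra.Homology Literature.Algebra.Homology.DiscreteRep Literature.Algebra.Homology.ExtPresentation

variable {K : Type} [Field K] [NumberField K] (E : GalLayer K)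
variable {S : ShortComplex (DiscreteRepCat ℤ (absoluteGaloisGroup K))} (hS : S.ShortExact)
  (h₁ : ∀ σ ∈ E.openNormalSubgroup, ∀ x : S.X₁.obj.V, S.X₁.obj.ρ σ x = x)
  (h₂ : ∀ σ ∈ E.openNormalSubgroup, ∀ x : S.X₂.obj.V, S.X₂.obj.ρ σ x = x)
  [Module.Finite ℤ (LCarrier S.X₁)] [Module.Finite ℤ (LCarrier S.X₂)] [Module.Finite ℤ (LCarrier S.X₃)]

/-! ## §1 Hom level: `∂(u₀ ≫ (F̄ˣ → J̄)) = 0` from local extensions -/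

omit [Module.Finite ℤ (LCarrier S.X₃)] in
include h₁ h₂ in
/-- **`y ∘ [F̄ˣ → J̄] = 0` for `y = ∂ u₀` when `ι_v ∘ u₀` extends locally along `ι` at every place** (the `Ext¹` form of
`exists_comp_eq_unitsToIdele_of_localExtensions`). [cite: MilneADT2006, I Theorem 4.10 (proof, p. 58), I Lemma 4.13]
[cite: Weibel1994, Theorem 2.7.6] -/
theorem boundary_comp_unitsToIdele_eq_zero_of_localExtensions (u₀ : S.X₁ ⟶ unitsBarD K)
    (hloc : ∀ v : Place K,
      ∃ e : (homGaloisModule ((toDGM S.X₂).restrictField (Place.Completion v)) (units (Place.Completion v))).toTopRep.ρ.invariants,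
        precomp ((toDGM S.X₁).restrictField (Place.Completion v)) ((toDGM S.X₂).restrictField (Place.Completion v))
          (units (Place.Completion v)) (restrictIntertwining (toDGM S.X₁) (toDGM S.X₂) (lmap S.X₁ S.X₂ S.f)) e.1 =
        (transferInvariant (toDGM S.X₁) (units K) (units (Place.Completion v)) (unitsTransfer K (Place.Completion v))
          (unitsInvariant S.X₁ u₀)).1) :
    (boundary hS (unitsBarD K) u₀).comp (Ext.mk₀ (unitsToIdele K).limitHom) (add_zero 1) = 0 := by
  rw [← boundary_comp, boundary_eq_zero_iff]
  exact exists_comp_eq_unitsToIdele_of_localExtensions E S.f h₁ h₂ u₀ hloc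

/-! ## §2 Native local form: the local classes `δ₀^{K_v}(ι_v ∘ u₀)` vanish -/

include h₁ h₂ in
/-- **Idèle-torus Hasse principle, native local form.**  If at every place `v` the native class
`δ₀^{K_v}(ι_v ∘ u₀) ∈ H¹(K_v, Hom_ℤ(X, K̄_vˣ))` of the transferred equivariant map `ι_v ∘ u₀ : X₁ → K̄_vˣ` (for the
restricted sequence `S|_v`) vanishes, then `(∂ u₀) ∘ [F̄ˣ → J̄] = 0` in `Ext¹_{C_Γ}(X, J̄)`.
[cite: MilneADT2006, I Theorem 4.10 (proof, p. 58), I Lemma 4.13] [cite: CasselsFrohlichANT1967, Ch. VII §8 Prop. 8.1] -/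
theorem boundary_comp_unitsToIdele_eq_zero_of_forall_dualδ₀_eq_zero (u₀ : S.X₁ ⟶ unitsBarD K)
    (hloc : ∀ v : Place K,
      dualδ₀ ((toDGM S.X₁).restrictField (Place.Completion v)) ((toDGM S.X₂).restrictField (Place.Completion v))
        ((toDGM S.X₃).restrictField (Place.Completion v)) (units (Place.Completion v))
        (restrictIntertwining (toDGM S.X₁) (toDGM S.X₂) (lmap S.X₁ S.X₂ S.f))
        (restrictIntertwining (toDGM S.X₂) (toDGM S.X₃) (lmap S.X₂ S.X₃ S.g))
        (isSES_restrict (toDGM S.X₁) (toDGM S.X₂) (toDGM S.X₃) (isSES_toDGM hS))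
        (baer_unitsCarrier (Place.Completion v))
        (transferInvariant (toDGM S.X₁) (units K) (units (Place.Completion v)) (unitsTransfer K (Place.Completion v))
          (unitsInvariant S.X₁ u₀)) = 0) :
    (boundary hS (unitsBarD K) u₀).comp (Ext.mk₀ (unitsToIdele K).limitHom) (add_zero 1) = 0 := by
  refine boundary_comp_unitsToIdele_eq_zero_of_localExtensions E hS h₁ h₂ u₀ fun v => ?_
  obtain ⟨q, hq⟩ := (dualδ₀_eq_zero_iff _ _ _ _ _ _ _ _ _).1 (hloc v)
  exact ⟨q, hq.symm⟩

/-! ## §3 Native global form: the global class `δ₀(ι ∘ u₀) ∈ H¹(K, Hom_ℤ(X, K̄ˣ))` is locally trivial -/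

include h₁ h₂ in
/-- **Idèle-torus Hasse principle, native global form.**  Let `ξ = δ₀(ι ∘ u₀) ∈ H¹(K, Hom_ℤ(X, K̄ˣ))` be the native
class of `∂ u₀ ∈ Ext¹_{C_Γ}(X, F̄ˣ)` (Milne I 0.8).  If for every place `v` the restriction `res_v ξ`, pushed along
`K̄ˣ|_v → K̄_vˣ`, vanishes in `H¹(K_v, Hom_ℤ(X, K̄_vˣ))` (i.e. `ξ ∈ Ш¹(K, T)` for the torus `T` with character lattice
`X`), then `(∂ u₀) ∘ [F̄ˣ → J̄] = 0` in `Ext¹_{C_Γ}(X, J̄)`.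
[cite: MilneADT2006, I §0 (0.8), I Theorem 4.10 (proof, p. 58), I Lemma 4.13] -/
theorem boundary_comp_unitsToIdele_eq_zero_of_forall_map_res_dualδ₀_eq_zero (u₀ : S.X₁ ⟶ unitsBarD K)
    (hloc : ∀ v : Place K,
      galoisCohomology.map (postcompRes (toDGM S.X₃) (units K) (units (Place.Completion v))
          (unitsTransfer K (Place.Completion v))) 1
        (galoisCohomology.res (homGaloisModule (toDGM S.X₃) (units K)) (Place.Completion v) 1
          (dualδ₀ (toDGM S.X₁) (toDGM S.X₂) (toDGM S.X₃) (units K) (lmap S.X₁ S.X₂ S.f) (lmap S.X₂ S.X₃ S.g)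
            (isSES_toDGM hS) (baer_unitsCarrier K) (unitsInvariant S.X₁ u₀))) = 0) :
    (boundary hS (unitsBarD K) u₀).comp (Ext.mk₀ (unitsToIdele K).limitHom) (add_zero 1) = 0 := by
  refine boundary_comp_unitsToIdele_eq_zero_of_forall_dualδ₀_eq_zero E hS h₁ h₂ u₀ fun v => ?_
  rw [← map_res_dualδ₀_eq (toDGM S.X₁) (toDGM S.X₂) (toDGM S.X₃) (units K) (units (Place.Completion v))
    (unitsTransfer K (Place.Completion v)) (lmap S.X₁ S.X₂ S.f) (lmap S.X₂ S.X₃ S.g) (isSES_toDGM hS)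
    (baer_unitsCarrier K) (baer_unitsCarrier (Place.Completion v)) (unitsInvariant S.X₁ u₀)]
  exact hloc v

/-! ## §4 Class form: every class of `Ext¹(X, F̄ˣ)` is a boundary when `Ext¹(X₂, F̄ˣ) = 0` -/

include h₁ h₂ in
/-- **Class form.**  When `Ext¹_{C_Γ}(X₂, F̄ˣ) = 0` (e.g. `X₂` a permutation lattice: Hilbert 90,
`FreePresentation.ext_presLattice_unitsBarD_eq_zero`), a class `y ∈ Ext¹_{C_Γ}(X, F̄ˣ)` dies in `Ext¹_{C_Γ}(X, J̄)` as
soon as the native local classes of SOME (equivalently every) `u₀` with `∂ u₀ = y` vanish at every place.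
[cite: MilneADT2006, I Theorem 4.10 (proof, p. 58), I Lemma 4.13] [cite: Weibel1994, Theorem 2.7.6] -/
theorem comp_unitsToIdele_eq_zero_of_forall_dualδ₀_eq_zero (hP : ∀ z : Ext S.X₂ (unitsBarD K) 1, z = 0)
    (y : Ext S.X₃ (unitsBarD K) 1)
    (hloc : ∀ u₀ : S.X₁ ⟶ unitsBarD K, boundary hS (unitsBarD K) u₀ = y → ∀ v : Place K,
      dualδ₀ ((toDGM S.X₁).restrictField (Place.Completion v)) ((toDGM S.X₂).restrictField (Place.Completion v))
        ((toDGM S.X₃).restrictField (Place.Completion v)) (units (Place.Completion v))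
        (restrictIntertwining (toDGM S.X₁) (toDGM S.X₂) (lmap S.X₁ S.X₂ S.f))
        (restrictIntertwining (toDGM S.X₂) (toDGM S.X₃) (lmap S.X₂ S.X₃ S.g))
        (isSES_restrict (toDGM S.X₁) (toDGM S.X₂) (toDGM S.X₃) (isSES_toDGM hS))
        (baer_unitsCarrier (Place.Completion v))
        (transferInvariant (toDGM S.X₁) (units K) (units (Place.Completion v)) (unitsTransfer K (Place.Completion v))
          (unitsInvariant S.X₁ u₀)) = 0) :
    y.comp (Ext.mk₀ (unitsToIdele K).limitHom) (add_zero 1) = 0 := by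
  obtain ⟨u₀, rfl⟩ := boundary_surjective hS hP y
  exact boundary_comp_unitsToIdele_eq_zero_of_forall_dualδ₀_eq_zero E hS h₁ h₂ u₀ (hloc u₀ rfl)

end IdeleReadout

end Literature.NumberTheory.GaloisRepresentations

end
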